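import Literature.Analysis.Fourier.ConvolutionOperatorMultiplier
import HarnessLib

/-!
# Zero-average projection of translation-invariant kernels (the `M_k`-constants of a finite-range
# decomposition on the torus)

On a finite abelian group `G` (a discrete torus) a translation-invariant kernel `M` acts on ALL
fields, including the constants, whereas the covariances of a gradient (zero-average) Gaussian field
live on the zero-average subspace `𝒳 = {φ : Σ_x φ(x) = 0}` and are normalised to have ZERO-AVERAGE
kernels (Adams–Kotecký–Müller, Lemma 3.5: a translation-invariant operator on `𝒳` has a unique
zero-average kernel).  The passage is the projection `P = 1 − |G|⁻¹𝟙` onto `𝒳`: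

  `zeroAvg M := M − |G|⁻¹𝟙·M = P M = P M P`   (for translation-invariant `M`),

with kernel `zeroAvg M (x,y) = M(x,y) − |G|⁻¹ Σ_z M(0,z)`.  This is exactly how the constants
`M_k ≤ 0` of Buchholz's finite-range decomposition arise: a piece that is a polynomial in the
generator has kernel `0` outside its range, and «only the constant term of the polynomial contributes
to the kernel … for |x| ≥ L^k/2 … the kernel of 𝒜⁰ = id_{𝒳_N} is given by (δ₀ − L^{−Nd})»
(Buchholz, App. A, (A.9)–(A.10)), i.e. after zero-average normalisation the kernel equals the
constant `−|G|⁻¹·(total mass) ≤ 0` outside the range.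

## Contents
* `avgMatrix G` — the averaging matrix `|G|⁻¹𝟙`; its products, idempotence, symbol
  (`symbol_avgMatrix : σ(ψ) = [ψ = 1]`), and commutation with translation-invariant kernels;
* `zeroAvg M` — the zero-average projection; `zeroAvg_apply`, `sum_zeroAvg_apply` (zero row sums),
  `zeroAvg_apply_of_apply_eq_zero` (constant `−|G|⁻¹Σ_z M(0,z)` where `M` vanishes),
  `symbol_zeroAvg` (`σ_{zeroAvg M}(ψ) = σ_M(ψ)` for `ψ ≠ 1`, `= 0` at `ψ = 1`),
  `zeroAvg_eq_conj` (`= (1−P)ᴴ M (1−P)`), `posSemidef_zeroAvg`, `isHermitian_zeroAvg`,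
  `sum_apply_zero_nonneg` (the total mass of a positive kernel is `≥ 0`, so the constant is `≤ 0`).
The expression `M − (Matrix.of fun _ _ => |G|⁻¹) * M` is the one already used for the pseudo-inverse
decomposition (`FiniteRangeDecompositionPseudoInverse.pinv_eq_sum_frdPiecePow`); `zeroAvg_def'`
records the syntactic link.

## References
* [Buchholz2016] S. Buchholz, J. Funct. Anal. 275 (2018), arXiv:1603.06685 — App. A, (A.9)–(A.10)
  (the constants `M_k`), Sec. 2 (zero-average kernels).
* [AdamsKoteckyMuller2012] S. Adams, R. Kotecký, S. Müller, J. Funct. Anal. 264 (2013) — Lemma 3.5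
  (unique zero-average kernel of a translation-invariant operator on `𝒳_N`).
* [BauerschmidtBrydgesSlade2019] LNM 2242, §1.5.1 (Fourier analysis on the discrete torus).
-/

noncomputable section

open Finset

namespace Literature.Analysis.Fourier

variable {G : Type*} [AddCommGroup G] [Fintype G] [DecidableEq G]

/-! ## The averaging matrix -/

/-- The averaging matrix `|G|⁻¹𝟙` (all entries `|G|⁻¹`): the orthogonal projection onto the constants.
[folklore] -/
def avgMatrix (G : Type*) [Fintype G] : _root_.Matrix G G ℝ :=
  _root_.Matrix.of fun _ _ : G => (Fintype.card G : ℝ)⁻¹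

omit [AddCommGroup G] [DecidableEq G] in
/-- Entries of the averaging matrix. [cite: BauerschmidtBrydgesSlade2019, §1.5.1 (form)] -/
@[simp] theorem avgMatrix_apply (x y : G) : avgMatrix G x y = (Fintype.card G : ℝ)⁻¹ := rfl

omit [DecidableEq G] in
/-- The averaging matrix is translation invariant. [cite: BauerschmidtBrydgesSlade2019, §1.5.1 (form)] -/
theorem isTranslationInvariant_avgMatrix : IsTranslationInvariant (avgMatrix G) := fun _ _ _ => rfl

omit [AddCommGroup G] [DecidableEq G] in
/-- `(|G|⁻¹𝟙 · M)(x,y) = |G|⁻¹ Σ_z M(z,y)` (column averages). [cite: Buchholz2016, App. A, (A.9)–(A.10) (form)] -/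
theorem avgMatrix_mul_apply (M : _root_.Matrix G G ℝ) (x y : G) :
    (avgMatrix G * M) x y = (Fintype.card G : ℝ)⁻¹ * ∑ z, M z y := by
  simp [_root_.Matrix.mul_apply, Finset.mul_sum]

omit [AddCommGroup G] [DecidableEq G] in
/-- `(M · |G|⁻¹𝟙)(x,y) = |G|⁻¹ Σ_z M(x,z)` (row averages). [cite: Buchholz2016, App. A, (A.9)–(A.10) (form)] -/
theorem mul_avgMatrix_apply (M : _root_.Matrix G G ℝ) (x y : G) :
    (M * avgMatrix G) x y = (Fintype.card G : ℝ)⁻¹ * ∑ z, M x z := by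
  rw [_root_.Matrix.mul_apply]
  simp only [avgMatrix_apply]
  rw [← Finset.sum_mul, mul_comm]

omit [AddCommGroup G] [DecidableEq G] in
/-- Idempotence: `(|G|⁻¹𝟙)² = |G|⁻¹𝟙`. [cite: BauerschmidtBrydgesSlade2019, §1.5.1 (form)] -/
theorem avgMatrix_mul_avgMatrix [Nonempty G] : avgMatrix G * avgMatrix G = avgMatrix G := by
  ext x y
  rw [avgMatrix_mul_apply]
  simp only [avgMatrix_apply, Finset.sum_const, Finset.card_univ, nsmul_eq_mul]
  have hc : (Fintype.card G : ℝ) ≠ 0 := Nat.cast_ne_zero.mpr Fintype.card_ne_zero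
  field_simp

omit [AddCommGroup G] [DecidableEq G] in
/-- The averaging matrix is symmetric (real Hermitian). [cite: BauerschmidtBrydgesSlade2019, §1.5.1 (form)] -/
theorem conjTranspose_avgMatrix : (avgMatrix G).conjTranspose = avgMatrix G := by
  ext x y; simp [avgMatrix]

omit [DecidableEq G] in
/-- Row sums of a translation-invariant kernel do not depend on the row: `Σ_y M(x,y) = Σ_y M(0,y)`.
[cite: AdamsKoteckyMuller2012, Lemma 3.5 (form)] -/
theorem sum_apply_eq_sum_apply_zero {M : _root_.Matrix G G ℝ} (hM : IsTranslationInvariant M) (x : G) :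
    ∑ y, M x y = ∑ y, M 0 y := by
  have h : ∀ y, M x y = M 0 (y - x) := fun y => hM.apply_eq x y
  simp_rw [h]
  exact Fintype.sum_equiv (Equiv.subRight x) _ _ fun y => rfl

omit [DecidableEq G] in
/-- Column sums of a translation-invariant kernel equal the row sums: `Σ_z M(z,y) = Σ_w M(0,w)`.
[cite: AdamsKoteckyMuller2012, Lemma 3.5 (form)] -/
theorem sum_apply_left_eq_sum_apply_zero {M : _root_.Matrix G G ℝ} (hM : IsTranslationInvariant M) (y : G) :
    ∑ z, M z y = ∑ w, M 0 w := by
  have h : ∀ z, M z y = M 0 (y - z) := fun z => hM.apply_eq z y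
  simp_rw [h]
  exact Fintype.sum_equiv (Equiv.subLeft y) _ _ fun z => rfl

omit [DecidableEq G] in
/-- Translation-invariant kernels commute with the averaging matrix. [cite: BauerschmidtBrydgesSlade2019, §1.5.1 (form)] -/
theorem avgMatrix_mul_eq_mul_avgMatrix {M : _root_.Matrix G G ℝ} (hM : IsTranslationInvariant M) :
    avgMatrix G * M = M * avgMatrix G := by
  ext x y
  rw [avgMatrix_mul_apply, mul_avgMatrix_apply, sum_apply_left_eq_sum_apply_zero hM y,
    sum_apply_eq_sum_apply_zero hM x]

/-- **Symbol of the averaging matrix**: `σ_{|G|⁻¹𝟙}(ψ) = 1` at the trivial character and `0`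
elsewhere (orthogonality of characters). [cite: BauerschmidtBrydgesSlade2019, §1.5.1 (form)] -/
theorem symbol_avgMatrix (ψ : AddChar G ℂ) :
    symbol (avgMatrix G) ψ = if ψ = 1 then 1 else 0 := by
  unfold symbol
  simp only [avgMatrix_apply]
  have h := sum_mul_apply_neg_eq_ite ψ (1 : AddChar G ℂ)
  simp only [AddChar.one_apply, mul_one] at h
  rw [← Finset.mul_sum, h]
  have hc : (Fintype.card G : ℂ) ≠ 0 := Nat.cast_ne_zero.mpr Fintype.card_ne_zero
  split_ifs
  · push_cast; field_simp
  · simp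

/-! ## The zero-average projection -/

/-- The **zero-average projection** of a kernel: `zeroAvg M := M − |G|⁻¹𝟙 · M` (`= P M P`,
`P = 1 − |G|⁻¹𝟙`, when `M` is translation invariant).  This is the zero-average-kernel
normalisation of covariances on the space of zero-average fields. [cite: Buchholz2016, App. A, (A.9)–(A.10)] -/
def zeroAvg (M : _root_.Matrix G G ℝ) : _root_.Matrix G G ℝ := M - avgMatrix G * M

omit [AddCommGroup G] [DecidableEq G] in
/-- Syntactic form used elsewhere in the tree (`pinv_eq_sum_frdPiecePow`):
`zeroAvg M = M − (Matrix.of fun _ _ => |G|⁻¹) * M`. [cite: Buchholz2016, App. A, (A.9)–(A.10) (form)] -/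
theorem zeroAvg_def' (M : _root_.Matrix G G ℝ) :
    zeroAvg M = M - (_root_.Matrix.of fun _ _ : G => (Fintype.card G : ℝ)⁻¹) * M := rfl

omit [DecidableEq G] in
/-- **Kernel of the projection**: `zeroAvg M (x,y) = M(x,y) − |G|⁻¹ Σ_z M(0,z)`.
[cite: Buchholz2016, App. A, (A.9)–(A.10)] -/
theorem zeroAvg_apply {M : _root_.Matrix G G ℝ} (hM : IsTranslationInvariant M) (x y : G) :
    zeroAvg M x y = M x y - (Fintype.card G : ℝ)⁻¹ * ∑ z, M 0 z := by
  rw [zeroAvg, _root_.Matrix.sub_apply, avgMatrix_mul_apply, sum_apply_left_eq_sum_apply_zero hM]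

omit [DecidableEq G] in
/-- The projection of a translation-invariant kernel is translation invariant.
[cite: AdamsKoteckyMuller2012, Lemma 3.5 (form)] -/
theorem isTranslationInvariant_zeroAvg {M : _root_.Matrix G G ℝ} (hM : IsTranslationInvariant M) :
    IsTranslationInvariant (zeroAvg M) :=
  hM.sub (isTranslationInvariant_avgMatrix.mul hM)

omit [DecidableEq G] in
/-- **Zero row sums** (the zero-average normalisation): `Σ_y zeroAvg M (x,y) = 0`.
[cite: AdamsKoteckyMuller2012, Lemma 3.5 (ii) (the zero-average kernel)] -/
theorem sum_zeroAvg_apply [Nonempty G] {M : _root_.Matrix G G ℝ} (hM : IsTranslationInvariant M) (x : G) :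
    ∑ y, zeroAvg M x y = 0 := by
  simp_rw [zeroAvg_apply hM]
  rw [Finset.sum_sub_distrib, sum_apply_eq_sum_apply_zero hM, Finset.sum_const, Finset.card_univ,
    nsmul_eq_mul]
  have hc : (Fintype.card G : ℝ) ≠ 0 := Nat.cast_ne_zero.mpr Fintype.card_ne_zero
  field_simp
  ring

omit [DecidableEq G] in
/-- **The constant outside the range** (Buchholz's `M_k`): where the original kernel vanishes, the
projected kernel equals the constant `−|G|⁻¹ Σ_z M(0,z)`. [cite: Buchholz2016, App. A, (A.9)–(A.10)] -/
theorem zeroAvg_apply_of_apply_eq_zero {M : _root_.Matrix G G ℝ} (hM : IsTranslationInvariant M)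
    {x y : G} (h : M x y = 0) :
    zeroAvg M x y = -((Fintype.card G : ℝ)⁻¹ * ∑ z, M 0 z) := by
  rw [zeroAvg_apply hM, h, zero_sub]

/-- **Symbol of the projection**: `σ_{zeroAvg M}(ψ) = σ_M(ψ)` off the trivial character and `0` at it.
[cite: BauerschmidtBrydgesSlade2019, §1.5.1 (form)] -/
theorem symbol_zeroAvg {M : _root_.Matrix G G ℝ} (hM : IsTranslationInvariant M) (ψ : AddChar G ℂ) :
    symbol (zeroAvg M) ψ = if ψ = 1 then 0 else symbol M ψ := by
  rw [zeroAvg, symbol_sub, symbol_mul ψ _ hM, symbol_avgMatrix]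
  split_ifs <;> ring

/-- The projection as a congruence: `zeroAvg M = (1 − |G|⁻¹𝟙)ᴴ · M · (1 − |G|⁻¹𝟙)` for
translation-invariant `M` (the averaging matrix is an idempotent commuting with `M`).
[cite: Buchholz2016, App. A, (A.9)–(A.10) (form)] -/
theorem zeroAvg_eq_conj [Nonempty G] {M : _root_.Matrix G G ℝ} (hM : IsTranslationInvariant M) :
    zeroAvg M = (1 - avgMatrix G).conjTranspose * M * (1 - avgMatrix G) := by
  have hc : M * avgMatrix G = avgMatrix G * M := (avgMatrix_mul_eq_mul_avgMatrix hM).symm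
  have hPMP : avgMatrix G * M * avgMatrix G = avgMatrix G * M := by
    rw [_root_.Matrix.mul_assoc, hc, ← _root_.Matrix.mul_assoc, avgMatrix_mul_avgMatrix]
  rw [_root_.Matrix.conjTranspose_sub, _root_.Matrix.conjTranspose_one, conjTranspose_avgMatrix,
    _root_.Matrix.sub_mul, _root_.Matrix.one_mul, _root_.Matrix.mul_sub, _root_.Matrix.mul_one,
    _root_.Matrix.sub_mul, hc, hPMP, sub_self, sub_zero]
  rfl

/-- **Positivity is preserved**: if `M` is positive semidefinite (and translation invariant) then so is
`zeroAvg M` — on ALL vectors, in particular on zero-average fields.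
[cite: Buchholz2016, App. A, (A.9)–(A.10) (positivity of the normalised pieces)] -/
theorem posSemidef_zeroAvg [Nonempty G] {M : _root_.Matrix G G ℝ} (hM : IsTranslationInvariant M)
    (hP : M.PosSemidef) : (zeroAvg M).PosSemidef := by
  rw [zeroAvg_eq_conj hM]
  exact hP.conjTranspose_mul_mul_same (1 - avgMatrix G)

/-- Symmetry is preserved. [cite: Buchholz2016, App. A, (A.9)–(A.10) (form)] -/
theorem isHermitian_zeroAvg [Nonempty G] {M : _root_.Matrix G G ℝ} (hM : IsTranslationInvariant M)
    (hs : M.IsHermitian) : (zeroAvg M).IsHermitian := by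
  rw [zeroAvg_eq_conj hM]
  exact _root_.Matrix.isHermitian_conjTranspose_mul_mul (1 - avgMatrix G) hs

omit [DecidableEq G] in
/-- The total mass of a positive translation-invariant kernel is nonnegative:
`0 ≤ Σ_z M(0,z)` (`= Re σ_M(1)`), so the constant `−|G|⁻¹Σ_z M(0,z)` of
`zeroAvg_apply_of_apply_eq_zero` is `≤ 0` — Buchholz's «M_k ≤ 0».
[cite: Buchholz2016, Thm. 2.4 (the sign of `M_k`), App. A, (A.10)] -/
theorem sum_apply_zero_nonneg {M : _root_.Matrix G G ℝ} (hM : IsTranslationInvariant M)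
    (hP : M.PosSemidef) : 0 ≤ ∑ z, M 0 z := by
  have h := symbol_re_nonneg (1 : AddChar G ℂ) hM hP
  unfold symbol at h
  simpa [Complex.re_sum] using h

omit [DecidableEq G] in
/-- The constant of `zeroAvg_apply_of_apply_eq_zero` is nonpositive for positive kernels.
[cite: Buchholz2016, Thm. 2.4 (the sign of `M_k`), App. A, (A.10)] -/
theorem zeroAvg_const_nonpos {M : _root_.Matrix G G ℝ} (hM : IsTranslationInvariant M)
    (hP : M.PosSemidef) : -((Fintype.card G : ℝ)⁻¹ * ∑ z, M 0 z) ≤ 0 := by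
  have := sum_apply_zero_nonneg hM hP
  have hc : (0 : ℝ) ≤ (Fintype.card G : ℝ)⁻¹ := by positivity
  nlinarith

end Literature.Analysis.Fourier

end
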